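import Literature.Probability.RandomPlanarGeometry.HexSAWSurfaceWallRenewal

/-!
# Wall order: a wall bridge meets its wall points from left to right

For the self-avoiding walk on the honeycomb lattice (brick-wall frame, `brickWallGraph`) in the half-plane `Y ≤ 0`, a
WALL BRIDGE `ω ∈ wbr n` (a brick-wall SAW from `(0,0)` with `Y_i ≤ 0`, `n` even, `Y_n = 0`, `0 ≤ X_i ≤ X_n`) visits the
wall `Y = 0` at the points `(X_i, 0)`, `Y_i = 0`; its SURFACE VISITS are the even such times `t ≥ 1` (`wallTimes`,
`visits`).  This module proves the basic planar-topological fact about these walks and its counting consequences: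

* `apply_lt_apply_of_wall` — WALL ORDER: if `i < k ≤ n` and `Y_i = Y_k = 0` then `X_i < X_k`; the wall points are met in
  strictly increasing order of abscissa (`apply_lt_apply_of_mem_wallTimes` for visit times).
* `step_from_wall`, `apply_succ_eq_of_wall_step` — from a wall point the walk steps RIGHT along the wall or DOWN; a step
  with both ends on the wall goes right.  `step_into_visit_from_left`, `step_from_visit_to_right` — a visit `(X_t, 0)`
  (`t` even, `X_t` even) is entered from `(X_t − 1, 0)` and left to `(X_t + 1, 0)` (deciding the directions left open by
  `step_into_wall_horizontal` / `wall_steps_horizontal` of `HexSAWSurfaceWallRenewalSixStep`, for all wall bridges).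
  `step_after_landing` — after resurfacing at `(X_s, 0)` from below, the walk steps right to `(X_s + 1, 0)`.
* `apply_add_two_le_apply_of_dive` — if the walk DIVES at time `a` (`Y_a = 0`, `Y_{a+1} = −1`; the column `X_a` is odd),
  every later wall point has `X ≥ X_a + 2`: the even column `X_a + 1` never carries a wall point (the unconditional form
  of the located gap `wallTimes_apply_ne_of_dive` of `HexSAWSurfaceWallRenewalSecondGap`).  `apply_not_mem_Ioo_of_wall` —
  no wall column lies strictly between two consecutive wall points.
* `two_mul_visits_add_one_eq`, `card_wallSteps_eq_two_mul_visits` — the WALL STEPS (`Y_t = Y_{t+1} = 0`) number exactly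
  `2v`, `v = visits n ω` (running form: `2 · visits m + 1 = #{t < m : wall step} + [m even ∧ Y_m = 0]`; dives happen at
  odd times from odd columns, resurfacings at odd times onto odd columns).
* `sum_sub_of_not_wall_step_eq` — NECK LEMMA (displacement form): the steps off the wall have total horizontal
  displacement `X_n − 2v`; equivalently the bodies of the walk (maximal excursions below the wall, from a dive at `(X_a, 0)`
  to the resurfacing at `(X_s, 0)`) have total width `Σ (X_s − X_a) = X_n − 2v`.
* `two_mul_visits_add_two_mul_card_dives_le_apply` — BODIES COST TWO COLUMNS EACH: `2v + 2·#{dives from the wall} ≤ X_n`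
  (the visit columns and the columns `X_a + 1` over the dives are distinct even numbers in `(0, X_n]`).  With one dive this
  is the gap count `2v + 2 ≤ X_n` of `HexSAWSurfaceWallRenewalSixStepRigid` (there for irreducible positive wall bridges);
  writing `X_n = 2v + 2 + e`, a wall bridge has at most `e/2 + 1` bodies.

PROOF OF WALL ORDER (§1–§2) — a lattice form of the Jordan curve theorem for a path hanging from a line, by a parity
(flux) count and without any appeal to planar topology.  Suppose `Y_i = Y_k = 0`, `i < k`, and `X_k < X_i`.  The prefix
`ω[0, i]` runs inside `Y ≤ 0` from `(0, 0)` to `(X_i, 0)` and avoids `(X_k, 0)`.  For a threshold column `e` and a height `b`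
let `F(e, b)` be the signed number of horizontal steps of the prefix crossing the line `x = e − 1/2` strictly below
height `b`, written as `Σ_{j<i} ([e ≤ X_{j+1}] − [e ≤ X_j]) · [Y_j < b]` (§1, kept inline — the module introduces no
definition).
Read at the running point of the continuation, `e = X_l + 1`, `b = Y_l` (`i < l ≤ n`), `F` is invariant along each lattice
step `l → l + 1`: moving the threshold across a point off the prefix changes `F` by a sum telescoping to zero
(`flux_succ_eq`), and raising the height cut across a point off the prefix changes it by the crossings AT that height, which
would pass through the point (`flux_height_succ_eq`); the points `ω l`, `l > i`, are off the prefix by self-avoidance.  At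
`l = n` no abscissa of the prefix exceeds `X_n`, so `F = 0` (`flux_eq_zero_of_lt`); at `l = k` all crossings of
`x = X_k + 1/2` by the prefix are below the wall (a crossing along the wall would pass through `(X_k, 0)`), so `F` is the
full signed crossing number `[X_k + 1 ≤ X_i] − [X_k + 1 ≤ X_0] = 1` (`flux_eq_one_of_wall`, `Finset.sum_range_sub`) — a
contradiction.
§2 reads the step directions off `brickWallGraph_adj_coord` (the vertical bond `(x, y)—(x, y+1)` exists iff `x + y` is
even) and `parity_apply`; §3 is an induction on the running count (`visits_succ`), the telescoping sum
`Σ_{t<n} (X_{t+1} − X_t) = X_n` split along wall steps (`Finset.sum_filter_add_sum_filter_not`), and `card_le_card_of_injOn`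
for the half-column map `t ↦ (X_t + 1)/2` on visit times and dive times.

STATUS: lane theorem of the a-idea-1 bridge/renewal lineage (cars 71 `…SixStep`, 73 `…SixStepRigid`, 74b-α `…SecondGap`,
75-α `…IteratedGap`); this is car 76 «wall order», the structural input (E2 «after resurfacing the walk steps right», E7
«neck lemma», «bodies ≤ e/2 + 1») of the classification of irreducible positive wall bridges at slack four and higher (lane
notes PROOF-slack4-PLAN §E).  It imports only the base module `HexSAWSurfaceWallRenewal` and applies to ALL wall bridges
`wbr n ⊇ pwb n ⊇ ipwb n`.  OURS (new in writing, elementary): the statements above; checked against the lane's enumeration of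
all `449 719` wall bridges of length `n ≤ 30` (calibrated by `#ipwb(n)` = 1, 0, 1, 1, 3, 7, 18, 49, 133, 373, 1066, 3078,
9038 for `n = 2, …, 26`, the tree's census): no failure; equality `2v + 2·#dives = X_n` is attained `8 519` times at
`n = 30`, where up to `5` dives occur.  The printed sources carry the bridge / half-space-walk set-up (Madras–Slade §1.2,
Definition 1.2.4 (bridges, p. 11); §3.1, Definition 3.1.2 (half-space walks, p. 58); §4.2, Definition 4.2.1 (irreducible
bridges, p. 90); Hammersley–Torrie–Whittington §2 (walks and bridges attached to a surface)), the brickwork frame of the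
honeycomb lattice (Enting–Jensen §7.4.2, Fig. 7.10) and the surface-visit statistic (Beaton et al. §3.1) — none states
these lemmas, which are folklore-level planar facts made explicit for the brick-wall frame.  No `set_option` line is used.
-/

namespace Literature.Probability.RandomPlanarGeometry.SAW.HexBW.Wall

open Finset
open Literature.Probability.LatticeModels Literature.Probability.Percolation SimpleGraph

variable {n : ℕ} {ω : ℕ → Site 2}

/-- [folklore] Two coordinates determine a site of `ℤ²`. -/
private theorem site_ext_word {p q : Site 2} (h0 : p 0 = q 0) (h1 : p 1 = q 1) : p = q := by
  funext k
  fin_cases k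
  · exact h0
  · exact h1

/-! ## §1 The flux of a prefix through a half-line (private machinery)

For the prefix `ω[0, i]` of a brick-wall walk, a threshold column `e` and a height `b`, the FLUX is the signed number
of horizontal steps `j → j + 1` (`j < i`) crossing the vertical line `x = e − 1/2` strictly below height `b`
(`+1` rightwards, `−1` leftwards), written as the telescoping-friendly sum
`Σ_{j<i} ([e ≤ X_{j+1}] − [e ≤ X_j]) · [Y_j < b]`.  The flux seen from the running point `(X_l, Y_l)` (`e = X_l + 1`,
`b = Y_l`) of the continuation `l > i` does not change along lattice steps avoiding the prefix (a discrete form of the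
Jordan curve theorem for a path hanging from the wall), vanishes at the right end of a wall bridge, and equals one at
any wall point strictly left of the prefix's last wall point. -/

/-- [folklore] The flux vanishes when no abscissa of the prefix reaches the threshold. -/
private theorem flux_eq_zero_of_lt {i : ℕ} {e b : ℤ} (hX : ∀ j ≤ i, ω j 0 < e) :
    ∑ j ∈ range i, ((if e ≤ ω (j + 1) 0 then (1 : ℤ) else 0) - (if e ≤ ω j 0 then 1 else 0)) *
      (if ω j 1 < b then 1 else 0) = 0 := by
  refine Finset.sum_eq_zero fun j hj => ?_
  rw [Finset.mem_range] at hj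
  rw [if_neg (by have := hX (j + 1) (by omega); omega), if_neg (by have := hX j (by omega); omega)]
  simp

/-- [folklore] The flux through `x = e − 1/2, y < 0` equals one when the prefix starts left of the threshold, ends
on or right of it, stays in `Y ≤ 0`, and avoids the wall point `(e − 1, 0)`: all its crossings are then below the
wall and their signed count telescopes to `[e ≤ X_i] − [e ≤ X_0] = 1`. -/
private theorem flux_eq_one_of_wall (hbw : IsBW n ω) {i : ℕ} (hin : i ≤ n) {e : ℤ} (h0 : ω 0 0 < e) (hi : e ≤ ω i 0)
    (hhp : ∀ j ≤ i, ω j 1 ≤ 0) (hoff : ∀ j ≤ i, ¬ (ω j 0 = e - 1 ∧ ω j 1 = 0)) :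
    ∑ j ∈ range i, ((if e ≤ ω (j + 1) 0 then (1 : ℤ) else 0) - (if e ≤ ω j 0 then 1 else 0)) *
      (if ω j 1 < 0 then 1 else 0) = 1 := by
  have key : ∀ j ∈ range i,
      ((if e ≤ ω (j + 1) 0 then (1 : ℤ) else 0) - (if e ≤ ω j 0 then 1 else 0)) * (if ω j 1 < 0 then 1 else 0) =
        (if e ≤ ω (j + 1) 0 then (1 : ℤ) else 0) - (if e ≤ ω j 0 then 1 else 0) := by
    intro j hj
    rw [Finset.mem_range] at hj
    by_cases hy : ω j 1 < 0
    · rw [if_pos hy, mul_one]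
    · have hy0 : ω j 1 = 0 := le_antisymm (hhp j (by omega)) (not_lt.1 hy)
      rw [if_neg hy, mul_zero]
      have hj0 := hoff j (by omega)
      have hj1 := hoff (j + 1) (by omega)
      rcases step_cases hbw (show j < n by omega) with ⟨hx, hy'⟩ | ⟨hx, hy'⟩ | ⟨hx, -⟩ | ⟨hx, -⟩ <;>
        split_ifs <;> omega
  rw [Finset.sum_congr rfl key, Finset.sum_range_sub (fun j => if e ≤ ω j 0 then (1 : ℤ) else 0) i,
    if_pos hi, if_neg (not_le.2 h0)]
  norm_num

/-- [folklore] Moving the threshold one column to the right across a point `(e, b)` off the prefix does not change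
the flux below height `b ≤ 0` (the prefix starts and ends on the wall): the difference telescopes over the
indicator of the half-line `x = e, y < b`, whose boundary point `(e, b)` the prefix avoids. -/
private theorem flux_succ_eq (hbw : IsBW n ω) {i : ℕ} (hin : i ≤ n) {e b : ℤ} (hb : b ≤ 0) (hy0 : ω 0 1 = 0)
    (hyi : ω i 1 = 0) (hoff : ∀ j ≤ i, ¬ (ω j 0 = e ∧ ω j 1 = b)) :
    ∑ j ∈ range i, ((if e ≤ ω (j + 1) 0 then (1 : ℤ) else 0) - (if e ≤ ω j 0 then 1 else 0)) *
        (if ω j 1 < b then 1 else 0) =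
      ∑ j ∈ range i, ((if e + 1 ≤ ω (j + 1) 0 then (1 : ℤ) else 0) - (if e + 1 ≤ ω j 0 then 1 else 0)) *
        (if ω j 1 < b then 1 else 0) := by
  rw [← sub_eq_zero, ← Finset.sum_sub_distrib]
  have key : ∀ j ∈ range i,
      ((if e ≤ ω (j + 1) 0 then (1 : ℤ) else 0) - (if e ≤ ω j 0 then 1 else 0)) * (if ω j 1 < b then 1 else 0) -
          ((if e + 1 ≤ ω (j + 1) 0 then (1 : ℤ) else 0) - (if e + 1 ≤ ω j 0 then 1 else 0)) *
            (if ω j 1 < b then 1 else 0) =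
        (if ω (j + 1) 0 = e ∧ ω (j + 1) 1 < b then (1 : ℤ) else 0) - (if ω j 0 = e ∧ ω j 1 < b then 1 else 0) := by
    intro j hj
    rw [Finset.mem_range] at hj
    have hj0 := hoff j (by omega)
    have hj1 := hoff (j + 1) (by omega)
    rcases step_cases hbw (show j < n by omega) with ⟨hx, hy⟩ | ⟨hx, hy⟩ | ⟨hx, hy⟩ | ⟨hx, hy⟩ <;>
      split_ifs <;> omega
  rw [Finset.sum_congr rfl key, Finset.sum_range_sub (fun j => if ω j 0 = e ∧ ω j 1 < b then (1 : ℤ) else 0) i,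
    if_neg (by omega), if_neg (by omega), sub_zero]

/-- [folklore] Raising the height cut from `b` to `b + 1` across a point `(e − 1, b)` off the prefix does not change
the flux: a horizontal step crossing `x = e − 1/2` at height `b` would pass through `(e − 1, b)`. -/
private theorem flux_height_succ_eq (hbw : IsBW n ω) {i : ℕ} (hin : i ≤ n) {e b : ℤ}
    (hoff : ∀ j ≤ i, ¬ (ω j 0 = e - 1 ∧ ω j 1 = b)) :
    ∑ j ∈ range i, ((if e ≤ ω (j + 1) 0 then (1 : ℤ) else 0) - (if e ≤ ω j 0 then 1 else 0)) *
        (if ω j 1 < b + 1 then 1 else 0) =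
      ∑ j ∈ range i, ((if e ≤ ω (j + 1) 0 then (1 : ℤ) else 0) - (if e ≤ ω j 0 then 1 else 0)) *
        (if ω j 1 < b then 1 else 0) := by
  refine Finset.sum_congr rfl fun j hj => ?_
  rw [Finset.mem_range] at hj
  have hj0 := hoff j (by omega)
  have hj1 := hoff (j + 1) (by omega)
  rcases step_cases hbw (show j < n by omega) with ⟨hx, hy⟩ | ⟨hx, hy⟩ | ⟨hx, hy⟩ | ⟨hx, hy⟩ <;>
    split_ifs <;> omega

/-! ## §2 Wall order -/

/-- **WALL ORDER.** Along a wall bridge the wall points `(X, 0)` are met in strictly increasing order of `X`: if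
`i < k ≤ n` and `Y_i = Y_k = 0` then `X_i < X_k`.  (Otherwise `(X_k, 0)` lies strictly left of `(X_i, 0)` and off the
prefix `ω[0, i]`, which runs from `(0,0)` to `(X_i, 0)` below the wall: the flux of the prefix through the half-line
under the running point of `ω[i, n]` is constant along the continuation, equals `1` at `(X_k, 0)` and `0` at the end
point `(X_n, 0)`, the rightmost column.)
[cite: MadrasSlade1993, §1.2, Definition 1.2.4 (bridges, p. 11) and §3.1, Definition 3.1.2 (half-space walks, p. 58);
HammersleyTorrieWhittington1982, §2 (surface bridges)] -/
theorem apply_lt_apply_of_wall (hw : ω ∈ wbr n) {i k : ℕ} (hik : i < k) (hkn : k ≤ n) (hyi : ω i 1 = 0)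
    (hyk : ω k 1 = 0) : ω i 0 < ω k 0 := by
  obtain ⟨ha, hwb⟩ := mem_wbr.1 hw
  obtain ⟨hh, -, -⟩ := mem_archs.1 ha
  obtain ⟨hs, hhp⟩ := mem_hpw.1 hh
  obtain ⟨h0, -, hbw, hinj⟩ := mem_saws_iff.1 hs
  have hX0 : ω 0 0 = 0 := by rw [h0]; rfl
  have hY0 : ω 0 1 = 0 := by rw [h0]; rfl
  by_contra hle
  rw [not_lt] at hle
  have hne : ω k 0 ≠ ω i 0 := fun he =>
    absurd (hinj (show k ∈ {j | j ≤ n} from hkn) (show i ∈ {j | j ≤ n} by simp; omega)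
      (site_ext_word he (by rw [hyk, hyi]))) (by omega)
  have hlt : ω k 0 + 1 ≤ ω i 0 := by omega
  have hc0 : ω 0 0 ≤ ω k 0 := (hwb k hkn).1
  -- no point of the prefix `ω[0, i]` is a later point of the walk
  have hoff : ∀ l, i < l → l ≤ n → ∀ j ≤ i, ¬ (ω j 0 = ω l 0 ∧ ω j 1 = ω l 1) := fun l hil hln j hj he =>
    absurd (hinj (show j ∈ {m | m ≤ n} by simp; omega) (show l ∈ {m | m ≤ n} from hln)
      (site_ext_word he.1 he.2)) (by omega)
  -- the flux of the prefix under the running point of the continuation is identically zero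
  have hconst : ∀ d l, l + d = n → i < l →
      ∑ j ∈ range i, ((if ω l 0 + 1 ≤ ω (j + 1) 0 then (1 : ℤ) else 0) - (if ω l 0 + 1 ≤ ω j 0 then 1 else 0)) *
        (if ω j 1 < ω l 1 then 1 else 0) = 0 := by
    intro d
    induction d with
    | zero =>
      intro l hl hil
      rw [add_zero] at hl
      subst hl
      exact flux_eq_zero_of_lt fun j hj => by have := (hwb j (by omega)).2; omega
    | succ d ih =>
      intro l hl hil
      have hln : l < n := by omega
      have ih' := ih (l + 1) (by omega) (by omega)
      have hol := hoff l hil hln.le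
      have hol' := hoff (l + 1) (by omega) (by omega)
      rcases step_cases hbw hln with ⟨hx, hy⟩ | ⟨hx, hy⟩ | ⟨hx, hy⟩ | ⟨hx, hy⟩
      · -- right step: move the threshold right across `ω (l+1)`
        rw [hx, hy] at ih'
        rw [flux_succ_eq hbw (by omega) (hhp l hln.le) hY0 hyi fun j hj h => hol' j hj (by rw [hx, hy]; exact h)]
        exact ih'
      · -- left step: move the threshold right across `ω l`, read backwards
        rw [hx, hy] at ih'
        have h2 := flux_succ_eq hbw (by omega) (b := ω l 1) (hhp l hln.le) hY0 hyi (e := ω l 0 - 1 + 1)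
          fun j hj h => hol j hj (by omega)
        rw [show ω l 0 - 1 + 1 + 1 = ω l 0 + 1 by ring] at h2
        rw [← h2]
        exact ih'
      · -- up step: raise the height cut across `ω l`
        rw [hx, hy] at ih'
        have h3 := flux_height_succ_eq hbw (by omega) (e := ω l 0 + 1) (b := ω l 1) fun j hj h => hol j hj (by omega)
        rw [← h3]
        exact ih'
      · -- down step: raise the height cut across `ω (l+1)`, read backwards
        rw [hx, hy] at ih'
        have h4 := flux_height_succ_eq hbw (by omega) (e := ω l 0 + 1) (b := ω l 1 - 1)
          fun j hj h => hol' j hj (by rw [hx, hy]; omega)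
        rw [show ω l 1 - 1 + 1 = ω l 1 by ring] at h4
        rw [h4]
        exact ih'
  have hk := hconst (n - k) k (by omega) hik
  rw [hyk] at hk
  have h1 := flux_eq_one_of_wall hbw (show i ≤ n by omega) (e := ω k 0 + 1) (by omega) hlt (fun j hj => hhp j (by omega))
    fun j hj h => hoff k hik hkn j hj ⟨by omega, by rw [h.2, hyk]⟩
  rw [hk] at h1
  exact zero_ne_one h1

/-- Wall order for the visit times: `t < t'` in `wallTimes` have `X_t < X_{t'}`.
[cite: MadrasSlade1993, §1.2, Definition 1.2.4 (bridges); HammersleyTorrieWhittington1982, §2 (surface bridges)] -/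
theorem apply_lt_apply_of_mem_wallTimes (hw : ω ∈ wbr n) {t t' : ℕ} (ht : t ∈ wallTimes n ω)
    (ht' : t' ∈ wallTimes n ω) (htt' : t < t') : ω t 0 < ω t' 0 := by
  rw [wallTimes, Finset.mem_filter, Finset.mem_Icc] at ht ht'
  exact apply_lt_apply_of_wall hw htt' ht'.1.2 ht.2.2 ht'.2.2

/-- From a wall point the walk steps RIGHT along the wall or DOWN — never left (wall order) and never up (half-plane).
[cite: MadrasSlade1993, §3.1, Definition 3.1.2 (half-space walks); EntingJensen2009, §7.4.2, Fig. 7.10] -/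
theorem step_from_wall (hw : ω ∈ wbr n) {t : ℕ} (htn : t < n) (hy : ω t 1 = 0) :
    (ω (t + 1) 0 = ω t 0 + 1 ∧ ω (t + 1) 1 = 0) ∨ (ω (t + 1) 0 = ω t 0 ∧ ω (t + 1) 1 = -1) := by
  obtain ⟨ha, -⟩ := mem_wbr.1 hw
  obtain ⟨hh, -, -⟩ := mem_archs.1 ha
  obtain ⟨hs, hhp⟩ := mem_hpw.1 hh
  obtain ⟨-, -, hbw, -⟩ := mem_saws_iff.1 hs
  have hY1 := hhp (t + 1) (by omega)
  rcases step_cases hbw htn with ⟨hx, hy'⟩ | ⟨hx, hy'⟩ | ⟨hx, hy'⟩ | ⟨hx, hy'⟩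
  · exact Or.inl ⟨hx, by rw [hy', hy]⟩
  · exfalso
    have := apply_lt_apply_of_wall hw (show t < t + 1 by omega) (by omega) hy (by rw [hy', hy])
    omega
  · exfalso; rw [hy] at hy'; omega
  · exact Or.inr ⟨hx, by rw [hy', hy]; norm_num⟩

/-- **Wall steps go right**: a step with both ends on the wall increases `X` by one.
[cite: MadrasSlade1993, §3.1, Definition 3.1.2 (half-space walks); EntingJensen2009, §7.4.2, Fig. 7.10] -/
theorem apply_succ_eq_of_wall_step (hw : ω ∈ wbr n) {t : ℕ} (htn : t < n) (hy : ω t 1 = 0)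
    (hy' : ω (t + 1) 1 = 0) : ω (t + 1) 0 = ω t 0 + 1 := by
  rcases step_from_wall hw htn hy with ⟨hx, -⟩ | ⟨-, hy1⟩
  · exact hx
  · rw [hy'] at hy1; omega

/-- **After a resurfacing the walk steps right**: if `ω` reaches the wall point `(X_s, 0)` from below at time
`s < n`, then `ω (s+1) = (X_s + 1, 0)` (going back down is the reversal, left and up are excluded).
[cite: MadrasSlade1993, §3.1, Definition 3.1.2 (half-space walks); EntingJensen2009, §7.4.2, Fig. 7.10] -/
theorem step_after_landing (hw : ω ∈ wbr n) {s : ℕ} (hs1 : 1 ≤ s) (hsn : s < n) (hys : ω s 1 = 0)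
    (hpr : ω (s - 1) 1 = -1) : ω (s + 1) 0 = ω s 0 + 1 ∧ ω (s + 1) 1 = 0 := by
  obtain ⟨ha, -⟩ := mem_wbr.1 hw
  obtain ⟨hh, -, -⟩ := mem_archs.1 ha
  obtain ⟨hs, -⟩ := mem_hpw.1 hh
  obtain ⟨-, -, hbw, hinj⟩ := mem_saws_iff.1 hs
  rcases step_from_wall hw hsn hys with h | ⟨hx, hy⟩
  · exact h
  · exfalso
    -- the step into `s` is the up step from `(X_s, −1) = ω (s+1)`
    have hup : ω (s - 1) 0 = ω s 0 := by
      rcases step_cases hbw (show s - 1 < n by omega) with ⟨-, hy'⟩ | ⟨-, hy'⟩ | ⟨hx', -⟩ | ⟨hx', -⟩ <;>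
        rw [show s - 1 + 1 = s by omega] at * <;> omega
    have := hinj (show s - 1 ∈ {m | m ≤ n} by simp; omega) (show s + 1 ∈ {m | m ≤ n} by simp; omega)
      (site_ext_word (by rw [hup, hx]) (by rw [hpr, hy]))
    omega

/-- **Visits are entered from the left**: the step into a visit `(X_t, 0)` (`t ∈ [1, n]` even, `Y_t = 0`, so
`X_t` is even) comes from `(X_t − 1, 0)` — not from the right (wall order), not from below (the vertical bond under
an even wall site is not a brick-wall bond), not from above (half-plane).  Decides the direction left open in
`step_into_wall_horizontal`. [cite: EntingJensen2009, §7.4.2, Fig. 7.10 (brickwork form of the honeycomb lattice)] -/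
theorem step_into_visit_from_left (hw : ω ∈ wbr n) {t : ℕ} (ht1 : 1 ≤ t) (htn : t ≤ n) (ht2 : t % 2 = 0)
    (hY : ω t 1 = 0) : ω (t - 1) 0 = ω t 0 - 1 ∧ ω (t - 1) 1 = 0 := by
  obtain ⟨ha, -⟩ := mem_wbr.1 hw
  obtain ⟨hh, -, -⟩ := mem_archs.1 ha
  obtain ⟨hs, hhp⟩ := mem_hpw.1 hh
  obtain ⟨-, -, hbw, -⟩ := mem_saws_iff.1 hs
  have hpar := parity_apply hs htn
  rw [hY] at hpar
  have hadj := (brickWallGraph_adj_coord _ _).1 (hbw (t - 1) (by omega))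
  rw [show t - 1 + 1 = t by omega] at hadj
  have hY' := hhp (t - 1) (by omega)
  rcases hadj with ⟨hx | hx, hy⟩ | ⟨hx, ⟨hy, hp⟩ | ⟨hy, hp⟩⟩
  · exact ⟨by omega, by rw [← hy, hY]⟩
  · -- from the right: excluded by wall order
    exfalso
    have := apply_lt_apply_of_wall hw (show t - 1 < t by omega) htn (by rw [← hy, hY]) hY
    omega
  · -- from below: the bond `(X_t, −1) — (X_t, 0)` needs `X_t` odd
    exfalso; rw [hY] at hy; rw [← hx] at hp; omega
  · -- from above: outside the half-plane
    exfalso; rw [hY] at hy; omega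

/-- **Visits are left to the right**: the step out of a visit `(X_t, 0)` (`t < n` even, `Y_t = 0`) goes to
`(X_t + 1, 0)`.  Decides the direction left open in `wall_steps_horizontal`.
[cite: EntingJensen2009, §7.4.2, Fig. 7.10 (brickwork form of the honeycomb lattice)] -/
theorem step_from_visit_to_right (hw : ω ∈ wbr n) {t : ℕ} (htn : t < n) (ht2 : t % 2 = 0) (hY : ω t 1 = 0) :
    ω (t + 1) 0 = ω t 0 + 1 ∧ ω (t + 1) 1 = 0 := by
  obtain ⟨ha, -⟩ := mem_wbr.1 hw
  obtain ⟨hh, -, -⟩ := mem_archs.1 ha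
  obtain ⟨hs, -⟩ := mem_hpw.1 hh
  obtain ⟨-, -, hbw, -⟩ := mem_saws_iff.1 hs
  have hpar := parity_apply hs htn.le
  rw [hY] at hpar
  rcases step_from_wall hw htn hY with h | ⟨hx, hy⟩
  · exact h
  · -- downwards: the bond `(X_t, 0) — (X_t, −1)` needs `X_t` odd
    exfalso
    have hadj := (brickWallGraph_adj_coord _ _).1 (hbw t htn)
    rcases hadj with ⟨-, hy'⟩ | ⟨-, ⟨hy', -⟩ | ⟨-, hp⟩⟩
    · rw [hy, hY] at hy'; omega
    · rw [hy, hY] at hy'; omega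
    · rw [hx, hy] at hp; omega

/-- **Dives are passed on the right, two columns on**: if the walk leaves the wall downwards at time `a`
(`Y_a = 0`, `Y_{a+1} = −1`; the column `X_a` is odd), every later wall point has `X ≥ X_a + 2` — the even column
`X_a + 1` is never visited on the wall (the wall point `(X_a + 1, 0)` could only be entered from `(X_a, 0)`, from the
right, or from below through an odd vertical bond).  Unconditional form of the located gap `wallTimes_apply_ne_of_dive`.
[cite: MadrasSlade1993, §3.1, Definition 3.1.2 (half-space walks); EntingJensen2009, §7.4.2, Fig. 7.10 (brickwork form
of the honeycomb lattice)] -/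
theorem apply_add_two_le_apply_of_dive (hw : ω ∈ wbr n) {a s : ℕ} (has : a < s) (hsn : s ≤ n) (hya : ω a 1 = 0)
    (hD : ω (a + 1) 1 = -1) (hys : ω s 1 = 0) : ω a 0 + 2 ≤ ω s 0 := by
  obtain ⟨ha, -⟩ := mem_wbr.1 hw
  obtain ⟨hh, -, -⟩ := mem_archs.1 ha
  obtain ⟨hs, hhp⟩ := mem_hpw.1 hh
  obtain ⟨-, -, hbw, hinj⟩ := mem_saws_iff.1 hs
  have hlt := apply_lt_apply_of_wall hw has hsn hya hys
  by_contra hge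
  have heq : ω s 0 = ω a 0 + 1 := by omega
  -- the down step at `a` leaves from an odd column
  have hpa := (brickWallGraph_adj_coord _ _).1 (hbw a (by omega))
  have hodd : (ω a 0 + (-1)) % 2 = 0 := by
    rcases hpa with ⟨_, h1⟩ | ⟨h0, ⟨h1, -⟩ | ⟨h1, h2⟩⟩
    · rw [hya] at h1; omega
    · rw [hya] at h1; omega
    · rw [h0, hD] at h2; exact h2
  -- the step into `s`
  have hs1 : 1 ≤ s := by omega
  rcases step_cases hbw (show s - 1 < n by omega) with ⟨hx, hy⟩ | ⟨hx, hy⟩ | ⟨hx, hy⟩ | ⟨hx, hy⟩ <;>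
    rw [show s - 1 + 1 = s by omega] at hx hy
  · -- from `(X_a, 0)`: that is `ω a`, so `s - 1 = a` and `ω s = ω (a+1)` is below the wall
    have hya' : ω (s - 1) 1 = 0 := by rw [← hy, hys]
    have := hinj (show s - 1 ∈ {m | m ≤ n} by simp; omega) (show a ∈ {m | m ≤ n} by simp; omega)
      (site_ext_word (by omega) (by rw [hya', hya]))
    have hsa : s = a + 1 := by omega
    rw [hsa, hD] at hys
    omega
  · -- from the right along the wall: excluded by wall order
    have hya' : ω (s - 1) 1 = 0 := by rw [← hy, hys]
    have := apply_lt_apply_of_wall hw (show s - 1 < s by omega) hsn hya' hys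
    omega
  · -- an up step into `(X_a + 1, 0)` would use an odd vertical bond
    have hps := (brickWallGraph_adj_coord _ _).1 (hbw (s - 1) (by omega))
    rw [show s - 1 + 1 = s by omega] at hps
    rcases hps with ⟨_, h1⟩ | ⟨h0, ⟨h1, h2⟩ | ⟨h1, -⟩⟩ <;> omega
  · have := hhp (s - 1) (by omega)
    omega

/-- Between two consecutive wall points (times `a < s` on the wall, nothing on the wall strictly between) no column
strictly between `X_a` and `X_s` is ever a wall column.
[cite: MadrasSlade1993, §3.1, Definition 3.1.2 (half-space walks); HammersleyTorrieWhittington1982, §2 (surface bridges)] -/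
theorem apply_not_mem_Ioo_of_wall (hw : ω ∈ wbr n) {a s t : ℕ} (has : a < s) (hsn : s ≤ n) (hya : ω a 1 = 0)
    (hys : ω s 1 = 0) (hgap : ∀ l, a < l → l < s → ω l 1 ≠ 0) (htn : t ≤ n) (hyt : ω t 1 = 0) :
    ω t 0 ≤ ω a 0 ∨ ω s 0 ≤ ω t 0 := by
  rcases lt_trichotomy t a with h | rfl | h
  · exact Or.inl (apply_lt_apply_of_wall hw h (by omega) hyt hya).le
  · exact Or.inl le_rfl
  · rcases lt_trichotomy t s with h' | rfl | h'
    · exact absurd hyt (hgap t h h')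
    · exact Or.inr le_rfl
    · exact Or.inr (apply_lt_apply_of_wall hw h' htn hys hyt).le

/-! ## §3 Counting along the wall -/

/-- The running count of wall steps: for `m ≤ n`,
`2 · visits m + 1 = #{t < m : Y_t = Y_{t+1} = 0} + [m even ∧ Y_m = 0]` (dives leave the wall at odd times,
resurfacings reach it at odd times). [cite: BeatonBousquetMelouDeGierDuminilCopinGuttmann2014, §3.1 (arXiv v5 p. 8)] -/
theorem two_mul_visits_add_one_eq (hw : ω ∈ wbr n) {m : ℕ} (hm : m ≤ n) :
    2 * visits m ω + 1 =
      #((range m).filter fun t => ω t 1 = 0 ∧ ω (t + 1) 1 = 0) + (if m % 2 = 0 ∧ ω m 1 = 0 then 1 else 0) := by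
  classical
  obtain ⟨ha, -⟩ := mem_wbr.1 hw
  obtain ⟨hh, -, -⟩ := mem_archs.1 ha
  obtain ⟨hs, hhp⟩ := mem_hpw.1 hh
  obtain ⟨h0, -, hbw, -⟩ := mem_saws_iff.1 hs
  have hY0 : ω 0 1 = 0 := by rw [h0]; rfl
  induction m with
  | zero => simp [hY0]
  | succ m ih =>
    have ih' := ih (by omega)
    rw [visits_succ, Finset.range_add_one, Finset.filter_insert]
    have hpm := parity_apply hs (show m ≤ n by omega)
    have hpm1 := parity_apply hs hm
    have hadj := (brickWallGraph_adj_coord _ _).1 (hbw m (by omega))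
    have hYm := hhp m (by omega)
    have hYm1 := hhp (m + 1) hm
    by_cases hst : ω m 1 = 0 ∧ ω (m + 1) 1 = 0
    · -- a wall step: exactly one of `m`, `m + 1` is even
      rw [if_pos hst, Finset.card_insert_of_notMem (by simp)]
      split_ifs at ih' ⊢ <;> omega
    · rw [if_neg hst]
      by_cases hm0 : ω m 1 = 0
      · -- a dive at `m`: odd column, odd time
        have hm1 : ω (m + 1) 1 ≠ 0 := fun h => hst ⟨hm0, h⟩
        have hodd : (ω m 0) % 2 = 1 := by
          rcases hadj with ⟨_, h1⟩ | ⟨hx0, ⟨h1, -⟩ | ⟨h1, h2⟩⟩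
          · rw [hm0] at h1; exact absurd h1 hm1
          · rw [hm0] at h1; omega
          · rw [hx0] at h2; rw [hm0] at h1; omega
        rw [hm0] at hpm
        split_ifs at ih' ⊢ <;> omega
      · by_cases hm1 : ω (m + 1) 1 = 0
        · -- a resurfacing at `m + 1`: odd column, odd time
          have hodd : (ω (m + 1) 0) % 2 = 1 := by
            rcases hadj with ⟨_, h1⟩ | ⟨hx0, ⟨h1, h2⟩ | ⟨h1, -⟩⟩
            · rw [hm1] at h1; exact absurd h1.symm hm0
            · rw [hm1] at h1
              have : ω m 1 = -1 := by omega
              rw [this, ← hx0] at h2; omega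
            · rw [hm1] at h1; omega
          rw [hm1] at hpm1
          split_ifs at ih' ⊢ <;> omega
        · split_ifs at ih' ⊢ <;> omega

/-- **The wall steps number `2v`**: `#{t < n : Y_t = Y_{t+1} = 0} = 2 · visits n ω` for a wall bridge.
[cite: BeatonBousquetMelouDeGierDuminilCopinGuttmann2014, §3.1 (arXiv v5 p. 8)] -/
theorem card_wallSteps_eq_two_mul_visits (hw : ω ∈ wbr n) :
    #((range n).filter fun t => ω t 1 = 0 ∧ ω (t + 1) 1 = 0) = 2 * visits n ω := by
  obtain ⟨ha, -⟩ := mem_wbr.1 hw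
  obtain ⟨-, hn2, hYn⟩ := mem_archs.1 ha
  have h := two_mul_visits_add_one_eq hw le_rfl
  rw [if_pos ⟨hn2, hYn⟩] at h
  omega

/-- **NECK LEMMA** (displacement form): the total horizontal displacement of the steps OFF the wall (the bodies of
the walk between a dive and the next resurfacing) is `X_n − 2v`: the `2v` wall steps each move one column to the
right. Equivalently `Σ_bodies (resurfacing column − dive column) = X_n − 2v`.
[cite: MadrasSlade1993, §3.1, Definition 3.1.2 (half-space walks);
BeatonBousquetMelouDeGierDuminilCopinGuttmann2014, §3.1 (arXiv v5 p. 8: surface visits)] -/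
theorem sum_sub_of_not_wall_step_eq (hw : ω ∈ wbr n) :
    ∑ t ∈ (range n).filter (fun t => ¬ (ω t 1 = 0 ∧ ω (t + 1) 1 = 0)), (ω (t + 1) 0 - ω t 0) =
      ω n 0 - 2 * visits n ω := by
  obtain ⟨ha, -⟩ := mem_wbr.1 hw
  obtain ⟨hh, -, -⟩ := mem_archs.1 ha
  obtain ⟨hs, -⟩ := mem_hpw.1 hh
  obtain ⟨h0, -, -, -⟩ := mem_saws_iff.1 hs
  have hX0 : ω 0 0 = 0 := by rw [h0]; rfl
  have htot : ∑ t ∈ range n, (ω (t + 1) 0 - ω t 0) = ω n 0 := by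
    rw [Finset.sum_range_sub (fun t => ω t 0) n, hX0, sub_zero]
  have hwall : ∑ t ∈ (range n).filter (fun t => ω t 1 = 0 ∧ ω (t + 1) 1 = 0), (ω (t + 1) 0 - ω t 0) =
      2 * visits n ω := by
    rw [show (2 : ℤ) * visits n ω = ((2 * visits n ω : ℕ) : ℤ) by push_cast; ring,
      ← card_wallSteps_eq_two_mul_visits hw, Finset.card_eq_sum_ones, Nat.cast_sum, Nat.cast_one]
    refine Finset.sum_congr rfl fun t ht => ?_
    rw [Finset.mem_filter, Finset.mem_range] at ht
    rw [apply_succ_eq_of_wall_step hw ht.1 ht.2.1 ht.2.2]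
    ring
  rw [← Finset.sum_filter_add_sum_filter_not (range n) (fun t => ω t 1 = 0 ∧ ω (t + 1) 1 = 0), hwall] at htot
  linear_combination htot

/-- **Bodies cost two columns each**: `2v + 2 · #{dives from the wall} ≤ X_n`, where a dive from the wall is a time
`t < n` with `Y_t = 0`, `Y_{t+1} = −1`.  (The visit columns and the columns `X_t + 1` over the dives are distinct even
numbers in `(0, X_n]`, by wall order and `apply_add_two_le_apply_of_dive`.)  With one dive this is the gap count
`2v + 2 ≤ X_n` of `HexSAWSurfaceWallRenewalSixStepRigid`; in the lane's notation (`X_n = 2v + 2 + e`) the number of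
bodies is at most `e/2 + 1`.
[cite: MadrasSlade1993, §4.2, Definition 4.2.1 and the remark before (4.2.21) (p. 94);
BeatonBousquetMelouDeGierDuminilCopinGuttmann2014, §3.1 (arXiv v5 p. 8: surface visits)] -/
theorem two_mul_visits_add_two_mul_card_dives_le_apply (hw : ω ∈ wbr n) :
    2 * (visits n ω : ℤ) + 2 * #((range n).filter fun t => ω t 1 = 0 ∧ ω (t + 1) 1 = -1) ≤ ω n 0 := by
  classical
  obtain ⟨ha, hwb⟩ := mem_wbr.1 hw
  obtain ⟨hh, hn2, hYn⟩ := mem_archs.1 ha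
  obtain ⟨hs, hhp⟩ := mem_hpw.1 hh
  obtain ⟨h0, -, hbw, hinj⟩ := mem_saws_iff.1 hs
  have hX0 : ω 0 0 = 0 := by rw [h0]; rfl
  have hY0 : ω 0 1 = 0 := by rw [h0]; rfl
  set T := wallTimes n ω with hT
  set DW := (range n).filter fun t => ω t 1 = 0 ∧ ω (t + 1) 1 = -1 with hDW
  have hXn : ω n 0 % 2 = 0 := by have := parity_apply hs le_rfl; rw [hYn] at this; omega
  -- parity: visit columns are even, dive columns odd; visits at even times, dives at odd times
  have hTmem : ∀ t ∈ T, 1 ≤ t ∧ t ≤ n ∧ t % 2 = 0 ∧ ω t 1 = 0 ∧ ω t 0 % 2 = 0 := by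
    intro t ht
    rw [hT, wallTimes, Finset.mem_filter, Finset.mem_Icc] at ht
    have := parity_apply hs ht.1.2
    rw [ht.2.2] at this
    exact ⟨ht.1.1, ht.1.2, ht.2.1, ht.2.2, by omega⟩
  have hDmem : ∀ t ∈ DW, t < n ∧ ω t 1 = 0 ∧ ω (t + 1) 1 = -1 ∧ ω t 0 % 2 = 1 ∧ t % 2 = 1 := by
    intro t ht
    rw [hDW, Finset.mem_filter, Finset.mem_range] at ht
    have hadj := (brickWallGraph_adj_coord _ _).1 (hbw t ht.1)
    have hodd : ω t 0 % 2 = 1 := by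
      rcases hadj with ⟨_, h1⟩ | ⟨hx0, ⟨h1, -⟩ | ⟨h1, h2⟩⟩
      · rw [ht.2.1, ht.2.2] at h1; omega
      · rw [ht.2.1, ht.2.2] at h1; omega
      · rw [hx0, ht.2.2] at h2; omega
    have := parity_apply hs ht.1.le
    rw [ht.2.1] at this
    exact ⟨ht.1, ht.2.1, ht.2.2, hodd, by omega⟩
  have hdisj : Disjoint T DW := by
    rw [Finset.disjoint_left]
    intro t ht hd
    have := (hTmem t ht).2.2.1
    have := (hDmem t hd).2.2.2.2
    omega
  -- the half-column map `t ↦ (X_t + 1)/2` is injective on `T ∪ DW` with values in `[1, X_n/2]`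
  have hmaps : ∀ t ∈ T ∪ DW, (ω t 0 + 1) / 2 ∈ Finset.Icc (1 : ℤ) (ω n 0 / 2) := by
    intro t ht
    rw [Finset.mem_Icc]
    rcases Finset.mem_union.1 ht with ht | ht
    · obtain ⟨ht1, htn, -, hyt, hev⟩ := hTmem t ht
      have hpos : 0 < ω t 0 := by
        have := apply_lt_apply_of_wall hw (show 0 < t by omega) htn hY0 hyt
        rw [hX0] at this; exact this
      have hle : ω t 0 ≤ ω n 0 := (hwb t htn).2
      constructor <;> omega
    · obtain ⟨htn, hyt, hD, hodd, -⟩ := hDmem t ht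
      have hpos : 0 ≤ ω t 0 := by have := (hwb t htn.le).1; rw [hX0] at this; exact this
      have h2 := apply_add_two_le_apply_of_dive hw htn le_rfl hyt hD hYn
      constructor <;> omega
  have hinjOn : Set.InjOn (fun t => (ω t 0 + 1) / 2) ↑(T ∪ DW) := by
    intro t ht t' ht' he
    simp only [Finset.coe_union, Set.mem_union, Finset.mem_coe] at ht ht'
    simp only at he
    -- wall points both; compare times
    have hyt : ω t 1 = 0 := by
      rcases ht with h | h
      · exact (hTmem t h).2.2.2.1
      · exact (hDmem t h).2.1
    have hyt' : ω t' 1 = 0 := by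
      rcases ht' with h | h
      · exact (hTmem t' h).2.2.2.1
      · exact (hDmem t' h).2.1
    have htn : t ≤ n := by
      rcases ht with h | h
      · exact (hTmem t h).2.1
      · exact (hDmem t h).1.le
    have htn' : t' ≤ n := by
      rcases ht' with h | h
      · exact (hTmem t' h).2.1
      · exact (hDmem t' h).1.le
    by_contra hne
    -- wlog `t < t'` by symmetry of the data: handle both orders
    rcases lt_or_gt_of_ne hne with hlt | hlt
    · have hxx := apply_lt_apply_of_wall hw hlt htn' hyt hyt'
      -- equal half-columns force `X_{t'} = X_t + 1` with `X_t` odd, i.e. `t` a dive: but then `X_{t'} ≥ X_t + 2`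
      rcases ht with h | h
      · have := (hTmem t h).2.2.2.2; omega
      · obtain ⟨htn0, -, hD, hodd, -⟩ := hDmem t h
        have := apply_add_two_le_apply_of_dive hw hlt htn' hyt hD hyt'
        omega
    · have hxx := apply_lt_apply_of_wall hw hlt htn hyt' hyt
      rcases ht' with h | h
      · have := (hTmem t' h).2.2.2.2; omega
      · obtain ⟨htn0, -, hD, hodd, -⟩ := hDmem t' h
        have := apply_add_two_le_apply_of_dive hw hlt htn hyt' hD hyt
        omega
  have hcard := Finset.card_le_card_of_injOn (fun t => (ω t 0 + 1) / 2) hmaps hinjOn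
  rw [Finset.card_union_of_disjoint hdisj, Int.card_Icc] at hcard
  have hv := visits_eq_card n ω
  rw [← hT] at hv
  have hnn : (0 : ℤ) ≤ ω n 0 / 2 + 1 - 1 := by
    have := (hwb n le_rfl).1; rw [hX0] at this; omega
  have h3 := Int.toNat_of_nonneg hnn
  omega

end Literature.Probability.RandomPlanarGeometry.SAW.HexBW.Wall
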